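import Summits.QuantumFields.BalabanUV.Beta.GAN24.CubicBackgroundGaugeLetter
import Summits.QuantumFields.BalabanUV.Beta.GAN24.ValueHessianLinearGauge
import Summits.QuantumFields.BalabanUV.Beta.ValueJetGeneric

/-!
# `BalabanUV.Beta.GAN24.CubicGaugeLetterLinearGrowth` — binder row G-an2-4 ∕ (CONV-C), W-slot (α-0), ROW (C) AT LEVELS `j ≥ 1`, letter L1′ of the (γ) hand's memo
# `HOME/b2b-balaban-gan24-formalise-leaf-06/g52/C-LEVELS-GE1.md` §17 (W2): **THE CUBIC BACKGROUND GAUGE LETTER FOR GAUGE FUNCTIONS OF LINEAR GROWTH — `Σ'_t Σ_κ (g(t + e_κ) − g t)·V_j κ t (x,z)_{ab}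
# = ½·E2_{j+1}(x,z)_{ab}·(g z − g x)`**, `V_j := e3OfK Lc G_j (SrecAt … j)` the E-sector generator of `SpureRecAt (j+1)`, every `g` with `|g t| ≤ A + B·|t|₁` (in particular the sawtooth
# `t ↦ t_ν % Lc − (Lc−1)∕2` and the staircase `t ↦ ⌊t_ν∕Lc⌋` of the exit-face profile) — every `j`, every in-block root, every `d`, `Lc ≥ 1`
# (G-an2-4 CRUX TEAM (2), seat `b2b-balaban-gan24-formalise-leaf-06` = the (γ) hand, gen 52; journal INTENT I-leaf06-g52-4)

NOT IN PRINT; OUR BOOKKEEPING ([folklore] Abel resummation BY NAME over this lineage's L1 `CubicBackgroundGaugeLetter.divV_e3OfK_SrecAt_inl_inl` (per-site letter: the `ff` entries of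
`divV V_j u` at `(x,z)` are `½·E2_{j+1}(x,z)·([z = u] − [x = u])` — supported on `u ∈ {x, z}`), an2's localisation `ValueJetGeneric.locStencil_e3OfK` ∕ leaf-10's
`WardLocusRecursive.locStencil_SrecAt`, and D1 `ValueHessianLinearGauge.summable_decay_mul_of_linGrowth`; 0 `def`, 0 cited fact, 0 `def … : Prop`, 0 sorry).
HONEST FRAMING (cell contract, verbatim): «discharging `BetaPertH` makes Bałaban's UV stability UNCONDITIONAL — a real constructive-QFT result; it is NOT the continuum
limit and NOT the Clay problem.»  HONEST DEPENDENCY (verbatim): «continuum YM on T⁴ ⇐ BetaPertH ∧ nine spine estimates (0/9 proved); BetaPertH ⇐ (D1) ∧ (D4) ∧ CAP+tail;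
G-an2-4 gates asym, D1 and NE2/3/4.»

WHY (memo §17 (W2)).  The dressed background of the level-`j` exchange word is the exit-face profile `Lc·𝟙f_ν = c̃_ν − d g_ν`, `g_ν(t) = t_ν % Lc` (`PiBmConstants.axProjBmAt_const`); the E-sector
cubic table contracted with `−d g_ν` is, by L1 and Abel resummation, the commutator `½(E2_{j+1}∘D_{g_ν} − D_{g_ν}∘E2_{j+1})` — L1 is typed for finitely supported gauge functions (a finite
`Σ_{u∈T}`); the sawtooth is bounded periodic and the staircase has linear growth, so the resummation is done here once for the whole linear-growth class (the per-site letter makes the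
right-hand side a two-term sum; only the left-hand side needs the decay of `V_j`).
* §1 **`tsum_smul_divV_e3OfK_SrecAt_inl_inl`** — `Σ'_u g u·(divV V_j u)(x,z)_{inl a, inl b} = ½·E2_{j+1}(x,z)_{ab}·(g z − g x)` for EVERY `g` (the series has two nonzero terms).
* §2 `summable_grad_mul_e3OfK`, **`tsum_grad_mul_e3OfK_SrecAt_inl_inl`** — the Abel-resummed form of the title for `g` of linear growth.
Asserts NO value of Bałaban's tables; discharges NOTHING of (C) ∕ (C)sym ∕ (Q-L) ∕ «T2Shape» ∕ «T2Drift» ∕ (hW, hWall); NEVER «G-an2-4 closed» as (CONV-C); NOT D1, NOT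
`BetaPertH`, NOT continuum, NOT Clay.  2026-08-23; no existing file touched.
-/

noncomputable section

open Finset
open scoped BigOperators
open Literature.MathematicalPhysics.QuantumFieldTheory
open Literature.MathematicalPhysics.QuantumFieldTheory.Balaban1983to89
open Literature.MathematicalPhysics.QuantumFieldTheory.Balaban1983to89.Beta
open B12Sec2to5 (l1 l1_nonneg)
open ExpKernelCalculus (Site MKer Decays BiLoc summable_exp_shift l1_sub_triangle l1_sub_symm)
open KernelWard (divV)
open AffineAveraging (box toSite unitVec)
open OneStepResolventKernel (Fib LocStencil)
open OneStepKernelFamily (KInvStep)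
open BalabanStepJetsSucc (E2)
open Summit.QuantumFields.BalabanUV.Beta.TameKernelCalculus
open Summit.QuantumFields.BalabanUV.Beta.AxialDressingRooted (coDressKBmAt decays_coDressKBmAt_KInvStep one_le_of_neZero)
open Summit.QuantumFields.BalabanUV.Beta.SpineRooted (e3OfK locStencil_e3OfK)
open Summit.QuantumFields.BalabanUV.Beta.WardLocusRecursive (SrecAt locStencil_SrecAt)
open Summit.QuantumFields.BalabanUV.Beta.WardLocusStencils (divV_apply)
open Summit.QuantumFields.BalabanUV.Beta.ValueHessianGauge (bUnitVec_eq)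
open Summit.QuantumFields.BalabanUV.Beta.GAN24.CubicBackgroundGaugeLetter (divV_e3OfK_SrecAt_inl_inl)
open Summit.QuantumFields.BalabanUV.Beta.GAN24.ValueHessianLinearGauge (summable_decay_mul_of_linGrowth)

namespace Summit.QuantumFields.BalabanUV.Beta.GAN24.CubicGaugeLetterLinearGrowth

variable {d : ℕ} {Lc : ℕ} [NeZero Lc]

/-! ## §1 The per-site letter summed against an arbitrary gauge function -/

/-- [folklore] **L1 AGAINST AN ARBITRARY GAUGE FUNCTION**: `Σ'_u g u·(divV V_j u)(x,z)_{inl a, inl b} = ½·E2 d Lc (j+1) (x,z)_{ab}·(g z − g x)` — the per-site letter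
`divV_e3OfK_SrecAt_inl_inl` makes the series a sum over `u ∈ {x, z}`. -/
theorem tsum_smul_divV_e3OfK_SrecAt_inl_inl {r : Fin (d + 1) → ℕ} (hr : r ∈ box (d + 1) Lc) (cΛ : ℝ) (j : ℕ) (g : (Fin (d + 1) → ℤ) → ℝ)
    (x z : Fin (d + 1) → ℤ) (a b : Fin (d + 1)) :
    ∑' u, g u * divV (e3OfK Lc (coDressKBmAt (toSite r) Lc (KInvStep (d := d) Lc j))
        (SrecAt d Lc (toSite r) ((Lc : ℝ) ^ (d + 1)) (-((Lc : ℝ) ^ (d + 1) * (1 / 2) * (Lc : ℝ) ^ (d + 1))) cΛ j)) u x z (Sum.inl a) (Sum.inl b) =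
      (1 / 2 : ℝ) * E2 d Lc (j + 1) x z (Sum.inl a) (Sum.inl b) * (g z - g x) := by
  classical
  simp only [divV_e3OfK_SrecAt_inl_inl hr cΛ j]
  rw [tsum_eq_sum (s := ({x, z} : Finset (Fin (d + 1) → ℤ))) (fun u hu => by
    have hx : x ≠ u := fun h => hu (by rw [h]; exact Finset.mem_insert_self _ _)
    have hz : z ≠ u := fun h => hu (by rw [h]; exact Finset.mem_insert_of_mem (Finset.mem_singleton_self _))
    rw [if_neg hz, if_neg hx, sub_self, mul_zero, mul_zero, mul_zero])]
  by_cases hxz : x = z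
  · subst hxz
    rw [show ({x, x} : Finset (Fin (d + 1) → ℤ)) = {x} from Finset.insert_eq_of_mem (Finset.mem_singleton_self x), Finset.sum_singleton]
    simp
  · rw [Finset.sum_pair hxz]
    simp only [if_true, if_neg hxz, if_neg (Ne.symm hxz)]
    ring

/-! ## §2 Abel resummation for gauge functions of linear growth -/

/-- [folklore] A stencil leg times a shifted gauge function of linear growth is summable over the slot:
`t ↦ g (t + v)·V κ t (x,z)_{ab}` (`V` a local stencil family at a positive rate). -/
theorem summable_shift_mul_locStencil {V : Fin (d + 1) → (Fin (d + 1) → ℤ) → MKer (d + 1) (Fib d)} {Cs δ : ℝ} (hV : LocStencil V Cs δ) (hδ : 0 < δ)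
    {g : (Fin (d + 1) → ℤ) → ℝ} {A B : ℝ} (hg : ∀ t, |g t| ≤ A + B * l1 t) (v : Fin (d + 1) → ℤ) (κ : Fin (d + 1)) (x z : Fin (d + 1) → ℤ)
    (a b : Fib d) : Summable fun t => g (t + v) * V κ t x z a b := by
  have hC : 0 ≤ Cs := by
    have h := hV κ x x x a a
    have hexp : 0 < Real.exp (-δ * (l1 (x - x) + l1 (x - x))) := Real.exp_pos _
    nlinarith [abs_nonneg (V κ x x x a a)]
  -- linear growth of the shifted function
  have hg' : ∀ t, |g (t + v)| ≤ (A + |B| * l1 v) + |B| * l1 t := by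
    intro t
    have h := hg (t + v)
    have ht : l1 (t + v) ≤ l1 t + l1 v := by
      have h3 := l1_sub_triangle (t + v) v 0
      simp only [sub_zero, add_sub_cancel_right] at h3
      linarith [l1_sub_symm (t + v) v]
    have hBl : B * l1 (t + v) ≤ |B| * (l1 t + l1 v) :=
      (le_abs_self _).trans (by rw [abs_mul, abs_of_nonneg (l1_nonneg _)]; gcongr)
    linarith
  have h := summable_decay_mul_of_linGrowth (K := fun t => V κ t x z a b) (C := Cs) hδ x (fun t => ?_) hg'
  · exact h.congr fun t => mul_comm _ _
  · calc |V κ t x z a b| ≤ Cs * Real.exp (-δ * (l1 (x - t) + l1 (z - t))) := hV κ t x z a b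
      _ ≤ Cs * Real.exp (-δ * l1 (x - t)) := by
          refine mul_le_mul_of_nonneg_left (Real.exp_le_exp.2 ?_) hC
          nlinarith [l1_nonneg (z - t)]

/-- [folklore] **ABEL RESUMMATION FOR A LOCAL STENCIL FAMILY**: for `V` a local stencil family at a positive rate and `g` of linear growth,
`Σ'_t Σ_κ (g(t + e_κ) − g t)·V κ t (x,z)_{ab} = Σ'_u g u·(divV V u)(x,z)_{ab}` (shift the first series by `e_κ`; all pieces absolutely summable). -/
theorem tsum_grad_mul_eq_tsum_mul_divV {V : Fin (d + 1) → (Fin (d + 1) → ℤ) → MKer (d + 1) (Fib d)} {Cs δ : ℝ} (hV : LocStencil V Cs δ) (hδ : 0 < δ)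
    {g : (Fin (d + 1) → ℤ) → ℝ} {A B : ℝ} (hg : ∀ t, |g t| ≤ A + B * l1 t) (x z : Fin (d + 1) → ℤ) (a b : Fib d) :
    ∑' t, ∑ κ, (g (t + unitVec κ) - g t) * V κ t x z a b = ∑' u, g u * divV V u x z a b := by
  have hf : ∀ κ : Fin (d + 1), Summable fun t => g (t + unitVec κ) * V κ t x z a b := fun κ =>
    summable_shift_mul_locStencil hV hδ hg (unitVec κ) κ x z a b
  have h0 : ∀ κ : Fin (d + 1), Summable fun t => g t * V κ t x z a b := fun κ => by
    have h := summable_shift_mul_locStencil hV hδ hg 0 κ x z a b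
    simpa using h
  have hs : ∀ κ : Fin (d + 1), Summable fun u => g u * V κ (u - unitVec κ) x z a b := fun κ => by
    have h := (Equiv.subRight (unitVec κ)).summable_iff.2 (hf κ)
    refine h.congr fun u => ?_
    simp only [Function.comp_apply, Equiv.subRight_apply, sub_add_cancel]
  have hshift : ∀ κ : Fin (d + 1), ∑' t, g (t + unitVec κ) * V κ t x z a b = ∑' u, g u * V κ (u - unitVec κ) x z a b := fun κ => by
    rw [← (Equiv.subRight (unitVec κ)).tsum_eq (fun t => g (t + unitVec κ) * V κ t x z a b)]
    refine tsum_congr fun u => ?_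
    simp only [Equiv.subRight_apply, sub_add_cancel]
  calc ∑' t, ∑ κ, (g (t + unitVec κ) - g t) * V κ t x z a b
      = ∑ κ, ∑' t, (g (t + unitVec κ) - g t) * V κ t x z a b :=
        Summable.tsum_finsetSum fun κ _ => ((hf κ).sub (h0 κ)).congr fun t => by ring
    _ = ∑ κ, ((∑' u, g u * V κ (u - unitVec κ) x z a b) - ∑' u, g u * V κ u x z a b) := by
        refine Finset.sum_congr rfl fun κ _ => ?_
        rw [← hshift κ, ← (hf κ).tsum_sub (h0 κ)]
        exact tsum_congr fun t => by ring
    _ = ∑ κ, ∑' u, g u * (V κ (u - unitVec κ) x z a b - V κ u x z a b) := by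
        refine Finset.sum_congr rfl fun κ _ => ?_
        rw [← (hs κ).tsum_sub (h0 κ)]
        exact tsum_congr fun u => by ring
    _ = ∑' u, ∑ κ, g u * (V κ (u - unitVec κ) x z a b - V κ u x z a b) :=
        (Summable.tsum_finsetSum fun κ _ => ((hs κ).sub (h0 κ)).congr fun u => by ring).symm
    _ = ∑' u, g u * divV V u x z a b := by
        refine tsum_congr fun u => ?_
        rw [← Finset.mul_sum, divV_apply]
        simp only [bUnitVec_eq]

/-- [folklore] **THE CUBIC BACKGROUND GAUGE LETTER FOR GAUGE FUNCTIONS OF LINEAR GROWTH** (Abel-resummed L1; every `j`, in-block root, every `d`, `Lc ≥ 1`):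
`Σ'_t Σ_κ (g(t + e_κ) − g t)·V_j κ t (x,z)_{inl a, inl b} = ½·E2 d Lc (j+1) (x,z)_{ab}·(g z − g x)`, `V_j = e3OfK Lc G_j (SrecAt … j)`, `|g t| ≤ A + B·|t|₁`. -/
theorem tsum_grad_mul_e3OfK_SrecAt_inl_inl {r : Fin (d + 1) → ℕ} (hr : r ∈ box (d + 1) Lc) (cΛ : ℝ) (j : ℕ) {g : (Fin (d + 1) → ℤ) → ℝ} {A B : ℝ}
    (hg : ∀ t, |g t| ≤ A + B * l1 t) (x z : Fin (d + 1) → ℤ) (a b : Fin (d + 1)) :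
    ∑' t, ∑ κ, (g (t + unitVec κ) - g t) *
        e3OfK Lc (coDressKBmAt (toSite r) Lc (KInvStep (d := d) Lc j))
          (SrecAt d Lc (toSite r) ((Lc : ℝ) ^ (d + 1)) (-((Lc : ℝ) ^ (d + 1) * (1 / 2) * (Lc : ℝ) ^ (d + 1))) cΛ j) κ t x z (Sum.inl a) (Sum.inl b) =
      (1 / 2 : ℝ) * E2 d Lc (j + 1) x z (Sum.inl a) (Sum.inl b) * (g z - g x) := by
  have hLc : 1 ≤ Lc := one_le_of_neZero Lc
  obtain ⟨Cs, δs, hδs, hS⟩ := locStencil_SrecAt (d := d) hLc hr ((Lc : ℝ) ^ (d + 1)) (-((Lc : ℝ) ^ (d + 1) * (1 / 2) * (Lc : ℝ) ^ (d + 1))) cΛ j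
  obtain ⟨C, δ, hδ, hV⟩ := locStencil_e3OfK (N := Lc) hLc (decays_coDressKBmAt_KInvStep (d := d) hr j) hS hδs
  rw [tsum_grad_mul_eq_tsum_mul_divV hV hδ hg x z (Sum.inl a) (Sum.inl b)]
  exact tsum_smul_divV_e3OfK_SrecAt_inl_inl hr cΛ j g x z a b

end Summit.QuantumFields.BalabanUV.Beta.GAN24.CubicGaugeLetterLinearGrowth

end
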